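import Summits.Ventures.Crystal3D.Theorems.StickyWulffConstantPolycrystalWulffBoundTwinSectionShiftSlab

/-!
# `PolycrystalWulffBound`, line `PolyDensity`: the slab-wise twin section shift for the three `⟨112⟩`
# zones of the truncated octahedron (crux `stmt-Ventures-19482`)

Route `StickyWulffConstant` of the venture `Summits/Ventures/Crystal3D`, second prover lane (poly-p2,
gen 9).  Instances of `fccWulffBody_twin_slab_cdf_le_of_zone` (`…TwinSectionShiftSlab.lean`) for the
three zone vectors `d₀ = (−2,1,1)`, `d₁ = (1,−2,1)`, `d₂ = (1,1,−2)`: for every measurable set `I` of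
heights `⟪x,(1,1,1)⟫`, every `ν` and `t`,
`|R_{(1,1,1)} W ∩ {⟪x,(1,1,1)⟫ ∈ I} ∩ {⟪x,ν⟫ < t}| ≤ |W ∩ {⟪x,(1,1,1)⟫ ∈ I} ∩ {⟪x,ν⟫ < t + |⟪d_k,ν⟫|/3}|`
(`fccWulffBody_twin_slab_cdf_le₀/₁/₂`; `|⟪d_k,ν⟫|/3 = (2/√6)|⟪d_k/√6, ν⟫|`; `reflection_swap_diag`: the
`{1 -1 0}` mirrors fix the cube diagonal).  For a horizontal `u` at `60°` from `d_k` (`u ∈ ⟨112⟩`, zone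
axis `w = (1,1,1) × u ∈ ⟨110⟩`) the shift is `≤ 1/√6 < 1/2` in every slab: the slice-wise input of the
m-first `⟨110⟩`-zone engine of memo P-TWIN-g8 §1 / P-TWIN-g9 §4(a).
WHAT THIS IS NOT: the engine; the crux-vocabulary transport; the crux is not claimed. -/

noncomputable section

open scoped BigOperators InnerProductSpace ENNReal
open MeasureTheory Set

namespace Summit.Ventures.Crystal3D.Theorems

open Summit.Ventures.Crystal3D.Cruxes.TextureLiminf.TexShadow (E3)
open Literature.MathematicalPhysics.StatisticalMechanics (fccWulffBody mem_fccWulffBody_iff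
  isCompact_fccWulffBody convex_fccWulffBody)

/-- The `{1 -1 0}` mirrors fix the cube diagonal. -/
theorem reflection_swap_diag :
    (ℝ ∙ (EuclideanSpace.single 1 (1 : ℝ) - EuclideanSpace.single 2 (1 : ℝ)))ᗮ.reflection
        (!₂[(1 : ℝ), 1, 1] : E3) = !₂[(1 : ℝ), 1, 1] ∧
    (ℝ ∙ (EuclideanSpace.single 0 (1 : ℝ) - EuclideanSpace.single 2 (1 : ℝ)))ᗮ.reflection
        (!₂[(1 : ℝ), 1, 1] : E3) = !₂[(1 : ℝ), 1, 1] ∧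
    (ℝ ∙ (EuclideanSpace.single 0 (1 : ℝ) - EuclideanSpace.single 1 (1 : ℝ)))ᗮ.reflection
        (!₂[(1 : ℝ), 1, 1] : E3) = !₂[(1 : ℝ), 1, 1] := by
  obtain ⟨⟨a0, a1, a2⟩, ⟨b0, b1, b2⟩, ⟨c0, c1, c2⟩⟩ := reflection_swap_coords (!₂[(1 : ℝ), 1, 1] : E3)
  refine ⟨?_, ?_, ?_⟩
  · ext l
    fin_cases l
    · simp [a0]
    · simp [a1]
    · simp [a2]
  · ext l
    fin_cases l
    · simp [b0]
    · simp [b1]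
    · simp [b2]
  · ext l
    fin_cases l
    · simp [c0]
    · simp [c1]
    · simp [c2]

/-- **Twin section shift slab by slab, zone `0`** (`d₀ = (−2,1,1)`): for every measurable set `I` of
heights, every `ν` and `t`,
`|R W ∩ {⟪x,(1,1,1)⟫ ∈ I} ∩ {⟪x,ν⟫ < t}| ≤ |W ∩ {⟪x,(1,1,1)⟫ ∈ I} ∩ {⟪x,ν⟫ < t + |⟪d₀,ν⟫|/3}|`. -/
theorem fccWulffBody_twin_slab_cdf_le₀ {I : Set ℝ} (hI : MeasurableSet I) (ν : E3) (t : ℝ) :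
    volume ((ℝ ∙ (!₂[(1 : ℝ), 1, 1] : E3))ᗮ.reflection '' fccWulffBody ∩
        {x : E3 | ⟪x, (!₂[(1 : ℝ), 1, 1] : E3)⟫_ℝ ∈ I} ∩ {x : E3 | ⟪x, ν⟫_ℝ < t}) ≤
      volume (fccWulffBody ∩ {x : E3 | ⟪x, (!₂[(1 : ℝ), 1, 1] : E3)⟫_ℝ ∈ I} ∩
        {x : E3 | ⟪x, ν⟫_ℝ < t + |⟪(!₂[(-2 : ℝ), 1, 1] : E3), ν⟫_ℝ| / 3}) := by
  have hdk : ⟪(!₂[(-2 : ℝ), 1, 1] : E3), (!₂[(1 : ℝ), 1, 1] : E3)⟫_ℝ = 0 := by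
    rw [(inner_cubic_vectors _).2.2.2]; simp; norm_num
  refine fccWulffBody_twin_slab_cdf_le_of_zone _ _ norm_sq_cubic_vectors.2.2.2 hdk
    (fun x hx hx1 => cap_reflect_mem_fccWulffBody₀ hx hx1) (reflection_swap_image_fccWulffBody (by decide))
    reflection_swap_diag.1 (fun n => (twin_identity₀ n).1) (fun n => ?_) hI ν t
  rw [(twin_identity₀ n).2, (inner_cubic_vectors n).2.2.2]
  ring

/-- **Twin section shift slab by slab, zone `1`** (`d₁ = (1,−2,1)`). -/
theorem fccWulffBody_twin_slab_cdf_le₁ {I : Set ℝ} (hI : MeasurableSet I) (ν : E3) (t : ℝ) :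
    volume ((ℝ ∙ (!₂[(1 : ℝ), 1, 1] : E3))ᗮ.reflection '' fccWulffBody ∩
        {x : E3 | ⟪x, (!₂[(1 : ℝ), 1, 1] : E3)⟫_ℝ ∈ I} ∩ {x : E3 | ⟪x, ν⟫_ℝ < t}) ≤
      volume (fccWulffBody ∩ {x : E3 | ⟪x, (!₂[(1 : ℝ), 1, 1] : E3)⟫_ℝ ∈ I} ∩
        {x : E3 | ⟪x, ν⟫_ℝ < t + |⟪(!₂[(1 : ℝ), -2, 1] : E3), ν⟫_ℝ| / 3}) := by
  have hdk : ⟪(!₂[(1 : ℝ), -2, 1] : E3), (!₂[(1 : ℝ), 1, 1] : E3)⟫_ℝ = 0 := by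
    rw [(inner_cubic_vectors _).2.2.1]; simp; norm_num
  refine fccWulffBody_twin_slab_cdf_le_of_zone _ _ norm_sq_cubic_vectors.2.2.1 hdk
    (fun x hx hx1 => cap_reflect_mem_fccWulffBody₁ hx hx1) (reflection_swap_image_fccWulffBody (by decide))
    reflection_swap_diag.2.1 (fun n => (twin_identity₁ n).1) (fun n => ?_) hI ν t
  rw [(twin_identity₁ n).2, (inner_cubic_vectors n).2.2.1]
  ring

/-- **Twin section shift slab by slab, zone `2`** (`d₂ = (1,1,−2)`). -/
theorem fccWulffBody_twin_slab_cdf_le₂ {I : Set ℝ} (hI : MeasurableSet I) (ν : E3) (t : ℝ) :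
    volume ((ℝ ∙ (!₂[(1 : ℝ), 1, 1] : E3))ᗮ.reflection '' fccWulffBody ∩
        {x : E3 | ⟪x, (!₂[(1 : ℝ), 1, 1] : E3)⟫_ℝ ∈ I} ∩ {x : E3 | ⟪x, ν⟫_ℝ < t}) ≤
      volume (fccWulffBody ∩ {x : E3 | ⟪x, (!₂[(1 : ℝ), 1, 1] : E3)⟫_ℝ ∈ I} ∩
        {x : E3 | ⟪x, ν⟫_ℝ < t + |⟪(!₂[(1 : ℝ), 1, -2] : E3), ν⟫_ℝ| / 3}) := by
  have hdk : ⟪(!₂[(1 : ℝ), 1, -2] : E3), (!₂[(1 : ℝ), 1, 1] : E3)⟫_ℝ = 0 := by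
    rw [(inner_cubic_vectors _).2.1]; simp; norm_num
  refine fccWulffBody_twin_slab_cdf_le_of_zone _ _ norm_sq_cubic_vectors.2.1 hdk
    (fun x hx hx1 => cap_reflect_mem_fccWulffBody₂ hx hx1) (reflection_swap_image_fccWulffBody (by decide))
    reflection_swap_diag.2.2 (fun n => (twin_identity₂ n).1) (fun n => ?_) hI ν t
  rw [(twin_identity₂ n).2, (inner_cubic_vectors n).2.1]
  ring

end Summit.Ventures.Crystal3D.Theorems

end
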